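import Literature.Barriers.MatrixMultiplication.TricoloredSumFreeBarrierProofs
import Literature.Combinatorics.Additive.TightTriangleRemoval
import HarnessLib

/-!
# The tricolored sum-free barrier is quantitative: explicit `ε_ℓ` in BCCGNSU 2017, Thm. B

Topic `Literature/Barriers/MatrixMultiplication`; sibling of `TricoloredSumFreeBarrier.lean`
(catalogue entry `TricoloredSumFreeBarrier`, PROVED in `TricoloredSumFreeBarrierProofs.lean`).
Outcome of the D-0021 barrier audit of that entry (2026-08-15): the printed Thm. B of
Blasiak–Church–Cohn–Grochow–Naslund–Sawin–Umans 2017 ("for every `ℓ` there is an `ε_ℓ > 0` such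
that no STPP construction in any abelian group of exponent at most `ℓ` yields a bound better than
`ω ≤ 2 + ε_ℓ` via (1.1)") is proved in print by contradiction (§3.2, with `o(1)`'s), and neither
the paper nor its sequels (Blasiak–Church–Cohn–Grochow–Umans 2017, Thm. 2.9 / Cor. 2.11;
Alman–Vassilevska Williams 2018, Thm. 6.1 "`ω_g(T_G) > 2`") print a value of `ε_ℓ`. The tree's
proof of Thm. B (`BlasiakChurchCohnGrochowNaslundSawinUmans2017_B_holds`) is effective — `ε = 3δ`
whenever all tricolored sum-free sets in the relevant powers have size `≤ 3·|G|^{1-δ}` — and this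
file extracts the resulting EXPLICIT barrier values:

* `sum_rpow_two_thirds_le_of_tsf` — the §3.2 engine with the tricolored-sum-free bound as an
  explicit hypothesis: `Σᵢ (|Aᵢ||Bᵢ||Cᵢ|)^{2/3} ≤ |H|^{1-δ}`;
* `sum_rpow_le_card_of_tsf` — hence `Σᵢ (|Aᵢ||Bᵢ||Cᵢ|)^{(2+3δ)/3} ≤ |H|` (no bound better than
  `ω ≤ 2 + 3δ` via (1.1)), using `|Aᵢ||Bᵢ||Cᵢ| ≤ |H|` (Cohn–Umans 2003, Lemma 3.1);
* `BCCGNSU2017_thmB_explicit` — **uniform explicit Thm. B**: exponent `≤ ℓ` ⟹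
  `ε_ℓ = 3ε/ℓ` with `ε = ½ log((2/3)2^{2/3}) = 0.02831…` (`bccgnsuEpsilon`), i.e.
  `ε_ℓ = 0.08494…/ℓ`, from Thm. A;
* `BCCGNSU2017_thmB_elementary` — **elementary abelian `p`-groups** (`p • x = 0`; `p` prime):
  `ε_p = 3c_p`, `c_p = −log J(p)/log p` the Fox–Lovász tight-removal exponent (the tree's
  `Literature.Combinatorics.Additive.foxLovaszExponent`, `TightTriangleRemoval.lean`), from the sharp
  Thm. 4.14; numerically
  `2 + ε_p = 2.2451 (p=2), 2.2325 (3), 2.2124 (5), 2.1980 (7), 2.1790 (11), 2.1722 (13), 2.1100 (101)`,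
  `ε_p ∼ 0.518/log p → 0`; with the proved estimates `J(p) ≤ e^{-δ}` (`p ≥ 2`) and
  `J(p) ≤ e^{-2δ}` (`p ≥ 7`) the closed forms `ε_p ≥ 3δ/log p` (`BCCGNSU2017_thmB_elementary_delta`)
  and `ε_p ≥ 6δ/log p` for `p ≥ 7` (`BCCGNSU2017_thmB_elementary_two_delta`), `δ = log((2/3)2^{2/3})`
  (`c_p ≥ δ/log p` is the tree's `bccgnsuDelta_div_log_le_foxLovaszExponent`).

Reading (scope of the barrier): every explicit value is `< 2.3713` (the 2024–25 record for `ω`),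
so Thm. B blocks `ω = 2` — indeed `ω < 2 + ε_ℓ` — via (1.1) from abelian groups of bounded exponent,
but it does not block improving the current record from ANY fixed exponent, not even from `𝔽₂ⁿ`;
and since Thm. 4.14 is sharp up to subexponential factors (Kleinberg–Sawin–Speyer, Norin, Pebody),
`ε_p` cannot be raised through the tricolored-sum-free step of the argument. For comparison, the
universal-method value for the FIXED tensor `D_{ℤ/p}` in characteristic `p` is
`2 log p / log(pJ(p)) = 2/(1-c_p)` (`= 2.16805` at `p = 3`), smaller than `2 + 3c_p` because (1.1)
additionally has the abelian packing `|Aᵢ||Bᵢ||Cᵢ| ≤ |H|` at its disposal.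

## References

* J. Blasiak, T. Church, H. Cohn, J. A. Grochow, E. Naslund, W. F. Sawin, C. Umans, *On cap sets
  and the group-theoretic approach to matrix multiplication*, Discrete Analysis 2017:3,
  arXiv:1605.06702: Thm. A, Thm. B, (1.1) (p. 3), Lemma 2.4 (p. 5), §3.2 (p. 9), Thm. 4.14.
* J. Blasiak, T. Church, H. Cohn, J. A. Grochow, C. Umans, *Which groups are amenable to proving
  exponent two for matrix multiplication?*, arXiv:1712.02302, Thm. 2.9, Cor. 2.11.
* J. Alman, V. Vassilevska Williams, *Limits on all known (and some unknown) approaches to matrix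
  multiplication*, FOCS 2018, arXiv:1810.08671, Thm. 6.1 and Rem. 6.1.
* H. Cohn, C. Umans, *A group-theoretic approach to fast matrix multiplication*, FOCS 2003,
  Lemma 3.1.
* J. Fox, L. M. Lovász, *A tight bound for Green's arithmetic triangle removal lemma in vector
  spaces*, Adv. Math. 321 (2017), §1 (the exponent `c_p`).
-/

noncomputable section

open scoped BigOperators
open Finset

namespace Literature.Barriers.MatrixMultiplication

open Literature.Combinatorics.Additive
open Literature.Computability.AlgebraicComplexity
open Literature.Computability.AlgebraicComplexity.Combinatorics

/-! ## The §3.2 engine with an explicit tricolored-sum-free hypothesis -/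

section Engine

/-- **BCCGNSU 2017, §3.2 made effective, explicit form.** Let `H` be a finite abelian group and
`δ` a real number such that, for all `N, N'`, every tricolored sum-free set in
`((H^N)^3)^{N'}` has size at most `3 · ((|H|^{1-δ})^{3N})^{N'}` (`= 3·|G|^{1-δ}` for that group
`G`). Then every STPP family `(Aᵢ, Bᵢ, Cᵢ)_{i ∈ ι₀}` in `H` satisfies
`Σᵢ (|Aᵢ||Bᵢ||Cᵢ|)^{2/3} ≤ |H|^{1-δ}`. (The tree's
`AddSimultaneousTPP.exists_sum_rpow_le` is this statement with `δ = δ_ℓ` supplied by the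
qualitative Thm. A; the proof is the same word-type / tensor-power argument, verbatim.)
[cite: BlasiakChurchCohnGrochowNaslundSawinUmans2017, §3.2] -/
theorem sum_rpow_two_thirds_le_of_tsf {H : Type} [AddCommGroup H] [Fintype H] [DecidableEq H]
    {δ : ℝ}
    (hA : ∀ (N N' : ℕ) (ι' : Type) [Fintype ι']
      (s t u : ι' → (Fin N' → (Fin N → H) × (Fin N → H) × (Fin N → H))),
      IsTricoloredSumFree s t u →
        (Fintype.card ι' : ℝ) ≤ 3 * (((Fintype.card H : ℝ) ^ (1 - δ)) ^ (3 * N)) ^ N')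
    {ι₀ : Type} [Fintype ι₀] [DecidableEq ι₀] {A B C : ι₀ → Finset H}
    (hS : AddSimultaneousTPP A B C) :
    ∑ i, (((A i).card * (B i).card * (C i).card : ℕ) : ℝ) ^ ((2 : ℝ) / 3) ≤
      (Fintype.card H : ℝ) ^ (1 - δ) := by
  set m : ι₀ → ℕ := fun i => (A i).card * (B i).card * (C i).card with hm
  set Y : ℝ := (Fintype.card H : ℝ) ^ (1 - δ) with hY
  have hHpos : (0 : ℝ) < Fintype.card H := by exact_mod_cast Fintype.card_pos
  have hYpos : 0 < Y := Real.rpow_pos_of_pos hHpos _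
  set F : ℝ := ∑ i, ((m i : ℕ) : ℝ) ^ ((2 : ℝ) / 3) with hF
  suffices hclaim : ∀ N : ℕ, 1 ≤ N →
      F ^ N ≤ (3 : ℝ) ^ ((1 : ℝ) / 3) * ((N : ℝ) + 1) ^ Fintype.card ι₀ * Y ^ N from
    le_of_pow_le_poly_mul_pow hYpos hclaim
  intro N hN
  set K : ℝ := Y ^ (3 * N) with hK
  have hKpos : 0 < K := pow_pos hYpos _
  have hTSF : ∀ (N' : ℕ) (ι' : Type) [Fintype ι']
      (s t u : ι' → (Fin N' → (Fin N → H) × (Fin N → H) × (Fin N → H))),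
      IsTricoloredSumFree s t u → (Fintype.card ι' : ℝ) ≤ 3 * K ^ N' :=
    fun N' ι' _ s t u hT => hA N N' ι' s t u hT
  have htype_bound := fun τ => hS.card_fiber_pow_three_mul_sq_le N hKpos hTSF τ
  -- expand `F^N` over words
  have hFN : F ^ N =
      ∑ u : Fin N → ι₀, (((∏ i, m i ^ (wordType u i : ℕ) : ℕ) : ℝ)) ^ ((2 : ℝ) / 3) := by
    have h1 : F ^ N = ∏ _l : Fin N, F := by rw [Finset.prod_const, card_univ, Fintype.card_fin]
    rw [h1, hF, Fintype.prod_sum (fun (_ : Fin N) (i : ι₀) => ((m i : ℕ) : ℝ) ^ ((2 : ℝ) / 3))]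
    refine Finset.sum_congr rfl fun u _ => ?_
    rw [Real.finsetProd_rpow _ _ (fun l _ => by positivity), ← prod_eq_prod_pow_wordType m u]
    push_cast
    rfl
  rw [hFN, ← Finset.sum_fiberwise_of_maps_to (g := wordType) (t := univ) (fun u _ => mem_univ _)]
  have h3 : (0 : ℝ) ≤ (3 : ℝ) ^ ((1 : ℝ) / 3) * Y ^ N :=
    mul_nonneg (Real.rpow_nonneg (by norm_num) _) (pow_nonneg hYpos.le _)
  have hτ : ∀ τ : ι₀ → Fin (N + 1),
      ∑ u ∈ univ.filter (fun u => wordType u = τ),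
        (((∏ i, m i ^ (wordType u i : ℕ) : ℕ) : ℝ)) ^ ((2 : ℝ) / 3) ≤
          3 ^ ((1 : ℝ) / 3) * Y ^ N := by
    intro τ
    rw [Finset.sum_congr rfl fun u hu => (show (((∏ i, m i ^ (wordType u i : ℕ) : ℕ) : ℝ)) ^
      ((2 : ℝ) / 3) = (((∏ i, m i ^ (τ i : ℕ) : ℕ) : ℝ)) ^ ((2 : ℝ) / 3) by
        rw [(mem_filter.1 hu).2]), Finset.sum_const, nsmul_eq_mul]
    set T : ℝ := (((univ : Finset (Fin N → ι₀)).filter fun u => wordType u = τ).card : ℝ) with hT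
    set P : ℝ := ((∏ i, m i ^ (τ i : ℕ) : ℕ) : ℝ) with hP
    have hP0 : 0 ≤ P := Nat.cast_nonneg _
    have hb : T ^ 3 * P ^ 2 ≤ 3 * K := htype_bound τ
    refine le_of_pow_le_pow_left₀ three_ne_zero h3 ?_
    calc (T * P ^ ((2 : ℝ) / 3)) ^ 3 = T ^ 3 * P ^ 2 := by
          rw [mul_pow, ← Real.rpow_natCast (P ^ ((2 : ℝ) / 3)) 3, ← Real.rpow_mul hP0]
          norm_num
      _ ≤ 3 * K := hb
      _ = ((3 : ℝ) ^ ((1 : ℝ) / 3) * Y ^ N) ^ 3 := by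
          rw [mul_pow, ← Real.rpow_natCast ((3 : ℝ) ^ ((1 : ℝ) / 3)) 3,
            ← Real.rpow_mul (by norm_num : (0 : ℝ) ≤ 3), hK, ← pow_mul, mul_comm N 3]
          norm_num
  calc ∑ τ : ι₀ → Fin (N + 1), ∑ u ∈ univ.filter (fun u => wordType u = τ),
        (((∏ i, m i ^ (wordType u i : ℕ) : ℕ) : ℝ)) ^ ((2 : ℝ) / 3)
      ≤ ∑ _τ : ι₀ → Fin (N + 1), (3 : ℝ) ^ ((1 : ℝ) / 3) * Y ^ N :=
        Finset.sum_le_sum fun τ _ => hτ τ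
    _ = (3 : ℝ) ^ ((1 : ℝ) / 3) * ((N : ℝ) + 1) ^ Fintype.card ι₀ * Y ^ N := by
        rw [Finset.sum_const, card_univ, nsmul_eq_mul, Fintype.card_fun, Fintype.card_fin]
        push_cast
        ring

/-- **Thm. B with explicit `ε = 3δ`** (the effective reading of "no bound better than
`ω ≤ 2 + 3δ` via (1.1)"): under the tricolored-sum-free hypothesis of
`sum_rpow_two_thirds_le_of_tsf` with `δ ≥ 0`, every STPP construction in `H` satisfies
`Σᵢ (|Aᵢ||Bᵢ||Cᵢ|)^{(2+3δ)/3} ≤ |H|`, because `|Aᵢ||Bᵢ||Cᵢ| ≤ |H|` (Cohn–Umans 2003, Lemma 3.1)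
gives `(|Aᵢ||Bᵢ||Cᵢ|)^{(2+3δ)/3} ≤ (|Aᵢ||Bᵢ||Cᵢ|)^{2/3} |H|^{δ}`.
[cite: BlasiakChurchCohnGrochowNaslundSawinUmans2017, Thm. B and §3.2] -/
theorem sum_rpow_le_card_of_tsf {H : Type} [AddCommGroup H] [Fintype H] [DecidableEq H]
    {δ : ℝ} (hδ : 0 ≤ δ)
    (hA : ∀ (N N' : ℕ) (ι' : Type) [Fintype ι']
      (s t u : ι' → (Fin N' → (Fin N → H) × (Fin N → H) × (Fin N → H))),
      IsTricoloredSumFree s t u →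
        (Fintype.card ι' : ℝ) ≤ 3 * (((Fintype.card H : ℝ) ^ (1 - δ)) ^ (3 * N)) ^ N')
    (N : ℕ) (A B C : Fin N → Finset H) (hS : IsSTPP A B C) :
    ∑ i, (((A i).card * (B i).card * (C i).card : ℕ) : ℝ) ^ ((2 + 3 * δ) / 3) ≤
      (Fintype.card H : ℝ) := by
  have hS' := (isSTPP_iff_addSimultaneousTPP A B C).1 hS
  have h := sum_rpow_two_thirds_le_of_tsf hA hS'
  have hHpos : (0 : ℝ) < Fintype.card H := by exact_mod_cast Fintype.card_pos
  have hexp_eq : (2 + 3 * δ) / 3 = (2 : ℝ) / 3 + δ := by ring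
  rw [hexp_eq]
  calc ∑ i, (((A i).card * (B i).card * (C i).card : ℕ) : ℝ) ^ ((2 : ℝ) / 3 + δ)
      = ∑ i, (((A i).card * (B i).card * (C i).card : ℕ) : ℝ) ^ ((2 : ℝ) / 3) *
          (((A i).card * (B i).card * (C i).card : ℕ) : ℝ) ^ δ := by
        refine Finset.sum_congr rfl fun i _ => ?_
        exact Real.rpow_add' (by positivity) (by positivity)
    _ ≤ ∑ i, (((A i).card * (B i).card * (C i).card : ℕ) : ℝ) ^ ((2 : ℝ) / 3) *
          (Fintype.card H : ℝ) ^ δ := by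
        refine Finset.sum_le_sum fun i _ => ?_
        refine mul_le_mul_of_nonneg_left ?_ (by positivity)
        refine Real.rpow_le_rpow (by positivity) ?_ hδ
        exact_mod_cast hS'.card_mul_card_mul_card_le i
    _ = (Fintype.card H : ℝ) ^ δ *
          ∑ i, (((A i).card * (B i).card * (C i).card : ℕ) : ℝ) ^ ((2 : ℝ) / 3) := by
        rw [← Finset.sum_mul, mul_comm]
    _ ≤ (Fintype.card H : ℝ) ^ δ * (Fintype.card H : ℝ) ^ (1 - δ) := by gcongr
    _ = Fintype.card H := by
        rw [← Real.rpow_add hHpos]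
        norm_num

/-- Monotonicity in `ε`: the quantity `Σᵢ (|Aᵢ||Bᵢ||Cᵢ|)^{(2+ε)/3}` is nondecreasing in `ε ≥ 0`
(each base is a natural number, `0` or `≥ 1`), so a barrier at `ε` is a barrier at every
`ε' ≤ ε`. [folklore] -/
theorem sum_rpow_mono {ι : Type*} (S : Finset ι) (m : ι → ℕ) {ε ε' : ℝ} (hε' : 0 ≤ ε')
    (h : ε' ≤ ε) :
    ∑ i ∈ S, ((m i : ℕ) : ℝ) ^ ((2 + ε') / 3) ≤ ∑ i ∈ S, ((m i : ℕ) : ℝ) ^ ((2 + ε) / 3) := by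
  refine Finset.sum_le_sum fun i _ => ?_
  rcases Nat.eq_zero_or_pos (m i) with h0 | hpos
  · have h1 : (0 : ℝ) < (2 + ε') / 3 := by linarith
    have h2 : (0 : ℝ) < (2 + ε) / 3 := by linarith
    rw [h0, Nat.cast_zero, Real.zero_rpow h1.ne', Real.zero_rpow h2.ne']
  · exact Real.rpow_le_rpow_of_exponent_le (by exact_mod_cast hpos) (by linarith)

end Engine

/-! ## Uniform explicit Thm. B: `ε_ℓ = 3ε/ℓ` for exponent `≤ ℓ` -/

section Uniform

/-- **BCCGNSU 2017, Thm. B with the explicit constant `ε_ℓ = 3ε/ℓ`**, `ε = ½ log((2/3)2^{2/3})`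
(`bccgnsuEpsilon = 0.02831…`, so `ε_ℓ = 0.08494…/ℓ`): every STPP construction in a finite abelian
group `H` of exponent at most `ℓ` satisfies `Σᵢ (|Aᵢ||Bᵢ||Cᵢ|)^{(2 + 3ε/ℓ)/3} ≤ |H|`, i.e. yields
no bound better than `ω ≤ 2 + 3ε/ℓ` via (1.1). Ingredients: the explicit Thm. A
(`BCCGNSU2017_thmA_holds`, exponent form `.of_exponent_le`) in the powers of `(H^N)^3` (exponent
still `≤ ℓ`, `card_le_of_isTricoloredSumFree_pi_prod`) and `sum_rpow_le_card_of_tsf`. The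
printed Thm. B only asserts `∃ ε_ℓ > 0` (proof by contradiction, §3.2).
[cite: BlasiakChurchCohnGrochowNaslundSawinUmans2017, Thm. A and Thm. B] -/
theorem BCCGNSU2017_thmB_explicit {ℓ : ℕ} (H : Type) [AddCommGroup H] [Fintype H]
    (hexp : AddMonoid.exponent H ≤ ℓ) (N : ℕ) (A B C : Fin N → Finset H) (hS : IsSTPP A B C) :
    ∑ i, (((A i).card * (B i).card * (C i).card : ℕ) : ℝ) ^ ((2 + 3 * (bccgnsuEpsilon / ℓ)) / 3) ≤
      (Fintype.card H : ℝ) := by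
  classical
  have hAℓ : ∀ (G : Type) [AddCommGroup G] [Fintype G], AddMonoid.exponent G ≤ ℓ →
      ∀ (ι : Type) [Fintype ι] (s t u : ι → G), IsTricoloredSumFree s t u →
        (Fintype.card ι : ℝ) ≤ 3 * (Fintype.card G : ℝ) ^ (1 - bccgnsuEpsilon / ℓ) :=
    fun G _ _ hG ι _ s t u h => BCCGNSU2017_thmA_holds.of_exponent_le G hG ι s t u h
  refine sum_rpow_le_card_of_tsf (div_nonneg bccgnsuEpsilon_pos.le (Nat.cast_nonneg ℓ))
    (fun N₁ N' ι' _ s t u hT => ?_) N A B C hS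
  exact card_le_of_isTricoloredSumFree_pi_prod hAℓ hexp N₁ N' ι' s t u hT

/-- The uniform explicit barrier in the route's wording: no STPP construction in a finite abelian
group of exponent `≤ ℓ` BEATS `|H|` at exponent `(2 + 3ε/ℓ)/3`.
[cite: BlasiakChurchCohnGrochowNaslundSawinUmans2017, Thm. B] -/
theorem not_beats_explicit {ℓ : ℕ} (H : Type) [AddCommGroup H] [Fintype H]
    (hexp : AddMonoid.exponent H ≤ ℓ) (N : ℕ) (A B C : Fin N → Finset H) (hS : IsSTPP A B C) :
    ¬ ((Fintype.card H : ℝ) <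
        ∑ i, (((A i).card * (B i).card * (C i).card : ℕ) : ℝ) ^ ((2 + 3 * (bccgnsuEpsilon / ℓ)) / 3)) :=
  not_lt.2 (BCCGNSU2017_thmB_explicit H hexp N A B C hS)

end Uniform

/-! ## Elementary abelian `p`-groups: the sharp constant `ε_p = 3c_p = 3(−log J(p))/log p` -/

section Elementary

/-- `c_p ≥ 2δ/log p` for `p ≥ 7` (`J(p) ≤ e^{-2δ}`, `bccgnsuJ_le_exp_neg_two_delta`), where
`c_p = −log J(p)/log p` (`foxLovaszExponent`); companion of the tree's
`bccgnsuDelta_div_log_le_foxLovaszExponent` (`c_p ≥ δ/log p`, `p ≥ 2`).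
[cite: BlasiakChurchCohnGrochowNaslundSawinUmans2017, Prop. 4.12] -/
theorem two_mul_bccgnsuDelta_div_log_le_foxLovaszExponent {p : ℕ} (hp : 7 ≤ p) :
    2 * bccgnsuDelta / Real.log p ≤ foxLovaszExponent p := by
  rw [foxLovaszExponent]
  have hp2 : 2 ≤ p := le_trans (by norm_num) hp
  have hlog : 0 < Real.log p := Real.log_pos (by exact_mod_cast hp2)
  refine div_le_div_of_nonneg_right ?_ hlog.le
  have hJ := bccgnsuJ_le_exp_neg_two_delta hp
  have hJpos := bccgnsuJ_pos (le_trans one_le_two hp2)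
  have := Real.log_le_log hJpos hJ
  rw [Real.log_exp] at this
  linarith

/-- For a finite elementary abelian `p`-group `G` (`p • x = 0`), `G ≃+ (ℤ/p)^d` for some `d`
(a finite-dimensional `𝔽_p`-vector space has a finite basis). [folklore] -/
theorem exists_addEquiv_pi_zmod {p : ℕ} [Fact p.Prime] (G : Type) [AddCommGroup G] [Finite G]
    (hG : ∀ x : G, p • x = 0) : ∃ d : ℕ, Nonempty (G ≃+ (Fin d → ZMod p)) := by
  let inst : Module (ZMod p) G := AddCommGroup.zmodModule hG
  have hfin : Module.Finite (ZMod p) G := @Module.Finite.of_finite (ZMod p) G _ _ inst _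
  have hfree : Module.Free (ZMod p) G := @Module.Free.of_divisionRing (ZMod p) G _ _ inst
  exact ⟨@Module.finrank (ZMod p) G _ _ inst,
    ⟨(@Module.finBasis (ZMod p) G _ _ inst hfree _ hfin).equivFun.toAddEquiv⟩⟩

/-- Thm. 4.14 (with trivial `G`) in exponent form for elementary abelian `p`-groups: every
tricolored sum-free set in `G` with `p • G = 0` has size at most `3 |G|^{1-c_p}`
(`|G| J(p)^d = |G|^{1-c_p}` when `|G| = p^d`; this is Fox–Lovász's normalisation
`p^{1-c_p} = p J(p)` of the Kleinberg–Sawin–Speyer / BCCGNSU bound).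
[cite: BlasiakChurchCohnGrochowNaslundSawinUmans2017, Thm. 4.14] -/
theorem card_le_rpow_of_elementary {p : ℕ} (hp : p.Prime) (G : Type) [AddCommGroup G]
    [Fintype G] (hG : ∀ x : G, p • x = 0) (ι : Type) [Fintype ι] (s t u : ι → G)
    (h : IsTricoloredSumFree s t u) :
    (Fintype.card ι : ℝ) ≤ 3 * (Fintype.card G : ℝ) ^ (1 - foxLovaszExponent p) := by
  haveI : Fact p.Prime := ⟨hp⟩
  obtain ⟨d, ⟨e⟩⟩ := exists_addEquiv_pi_zmod G hG
  have hiso : Nonempty (G ≃+ ((Fin d → ZMod p) × PUnit)) :=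
    ⟨e.trans (AddEquiv.prodUnique (M := Fin d → ZMod p) (N := PUnit)).symm⟩
  have h414 := BCCGNSU2017_thm414_holds p d hp.isPrimePow PUnit G hiso ι s t u h
  -- `|G| = p^d`
  have hp1 : 1 < p := hp.one_lt
  haveI : NeZero p := ⟨hp.ne_zero⟩
  have hcard : Fintype.card G = p ^ d := by
    rw [Fintype.card_congr e.toEquiv, Fintype.card_pi, Finset.prod_const, ZMod.card,
      Finset.card_univ, Fintype.card_fin]
  have hp0 : (0 : ℝ) < p := by exact_mod_cast hp.pos
  have hGpos : (0 : ℝ) < Fintype.card G := by exact_mod_cast Fintype.card_pos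
  have hJpos : 0 < bccgnsuJ p := bccgnsuJ_pos hp.one_lt.le
  have hlogp : Real.log p ≠ 0 := Real.log_ne_zero_of_pos_of_ne_one hp0 (by exact_mod_cast hp1.ne')
  -- `|G|^{1-c_p} = |G| · J(p)^d`
  have hlogG : Real.log (Fintype.card G : ℝ) = d * Real.log p := by
    rw [hcard]
    push_cast
    exact Real.log_pow _ _
  have hlogJ : Real.log (bccgnsuJ p) = -(foxLovaszExponent p * Real.log p) := by
    rw [foxLovaszExponent, div_mul_cancel₀ _ hlogp, neg_neg]
  have key : (Fintype.card G : ℝ) ^ (1 - foxLovaszExponent p) = Fintype.card G * bccgnsuJ p ^ d := by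
    rw [Real.rpow_def_of_pos hGpos, hlogG,
      show (d : ℝ) * Real.log p * (1 - foxLovaszExponent p) =
          d * Real.log p + d * Real.log (bccgnsuJ p) by rw [hlogJ]; ring,
      Real.exp_add, ← hlogG, Real.exp_log hGpos, Real.exp_nat_mul, Real.exp_log hJpos]
  rw [key, ← mul_assoc]
  exact h414

/-- Powers of products of powers of an elementary abelian `p`-group are elementary abelian
`p`-groups. [folklore] -/
theorem nsmul_eq_zero_pi_prod_pi {H : Type*} [AddCommGroup H] {p : ℕ} (hH : ∀ x : H, p • x = 0)
    (N N' : ℕ) (y : Fin N' → (Fin N → H) × (Fin N → H) × (Fin N → H)) : p • y = 0 := by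
  ext l j <;> simp [hH]

/-- **BCCGNSU 2017, Thm. B for elementary abelian `p`-groups with the sharp explicit constant
`ε_p = 3c_p = 3(−log J(p))/log p`** (`c_p` = the Fox–Lovász tight-removal exponent
`foxLovaszExponent`): if `p` is prime and `p • H = 0` (`H ≅ 𝔽_pⁿ`), every STPP construction in
`H` satisfies `Σᵢ (|Aᵢ||Bᵢ||Cᵢ|)^{(2+3c_p)/3} ≤ |H|` — no bound better than `ω ≤ 2 + 3c_p` via
(1.1). Numerically `2 + 3c_p = 2.2451 (p = 2), 2.2325 (3), 2.2124 (5), 2.1980 (7), 2.1790 (11),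
2.1722 (13), 2.1100 (101)`, `3c_p ∼ 0.518/log p`; all below the current record `ω < 2.3714`:
the barrier rules out `ω = 2` (indeed `ω < 2 + 3c_p`), not progress on `ω`, from any fixed `p`.
The tricolored-sum-free input (Thm. 4.14) is sharp up to `p^{o(n)}` (Kleinberg–Sawin–Speyer
2018), so `c_p` cannot be improved inside this argument.
[cite: BlasiakChurchCohnGrochowNaslundSawinUmans2017, Thm. B and Thm. 4.14] -/
theorem BCCGNSU2017_thmB_elementary {p : ℕ} (hp : p.Prime) (H : Type) [AddCommGroup H]
    [Fintype H] (hH : ∀ x : H, p • x = 0) (N : ℕ) (A B C : Fin N → Finset H)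
    (hS : IsSTPP A B C) :
    ∑ i, (((A i).card * (B i).card * (C i).card : ℕ) : ℝ) ^ ((2 + 3 * foxLovaszExponent p) / 3) ≤
      (Fintype.card H : ℝ) := by
  classical
  have hHpos : (0 : ℝ) < Fintype.card H := by exact_mod_cast Fintype.card_pos
  refine sum_rpow_le_card_of_tsf (foxLovaszExponent_pos hp.two_le).le
    (fun N₁ N' ι' _ s t u hT => ?_) N A B C hS
  have h := card_le_rpow_of_elementary hp (Fin N' → (Fin N₁ → H) × (Fin N₁ → H) × (Fin N₁ → H))
    (nsmul_eq_zero_pi_prod_pi hH N₁ N') ι' s t u hT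
  have hcardG : (Fintype.card (Fin N' → (Fin N₁ → H) × (Fin N₁ → H) × (Fin N₁ → H)) : ℝ) =
      (Fintype.card H : ℝ) ^ (3 * N₁ * N') := by
    rw [Fintype.card_fun, Fintype.card_prod, Fintype.card_prod, Fintype.card_fun,
      Fintype.card_fin, Fintype.card_fin]
    push_cast
    ring
  rw [hcardG] at h
  refine h.trans (le_of_eq ?_)
  rw [← pow_mul, ← Real.rpow_mul_natCast hHpos.le, ← Real.rpow_natCast_mul hHpos.le]
  congr 2
  push_cast
  ring

/-- The elementary barrier in the route's wording: no STPP construction in an elementary abelian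
`p`-group BEATS `|H|` at exponent `(2 + 3c_p)/3`.
[cite: BlasiakChurchCohnGrochowNaslundSawinUmans2017, Thm. B] -/
theorem not_beats_elementary {p : ℕ} (hp : p.Prime) (H : Type) [AddCommGroup H] [Fintype H]
    (hH : ∀ x : H, p • x = 0) (N : ℕ) (A B C : Fin N → Finset H) (hS : IsSTPP A B C) :
    ¬ ((Fintype.card H : ℝ) <
        ∑ i, (((A i).card * (B i).card * (C i).card : ℕ) : ℝ) ^ ((2 + 3 * foxLovaszExponent p) / 3)) :=
  not_lt.2 (BCCGNSU2017_thmB_elementary hp H hH N A B C hS)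

/-- Closed form `ε_p ≥ 3δ/log p` (`δ = log((2/3)2^{2/3}) = 0.05663…`; sharp at `p = 2`:
`2 + 3δ/log 2 = 2.2451…`): every STPP construction in an elementary abelian `p`-group satisfies
`Σᵢ (|Aᵢ||Bᵢ||Cᵢ|)^{(2+3δ/log p)/3} ≤ |H|`.
[cite: BlasiakChurchCohnGrochowNaslundSawinUmans2017, Thm. A′ and Thm. B] -/
theorem BCCGNSU2017_thmB_elementary_delta {p : ℕ} (hp : p.Prime) (H : Type) [AddCommGroup H]
    [Fintype H] (hH : ∀ x : H, p • x = 0) (N : ℕ) (A B C : Fin N → Finset H)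
    (hS : IsSTPP A B C) :
    ∑ i, (((A i).card * (B i).card * (C i).card : ℕ) : ℝ) ^
        ((2 + 3 * (bccgnsuDelta / Real.log p)) / 3) ≤ (Fintype.card H : ℝ) := by
  refine le_trans ?_ (BCCGNSU2017_thmB_elementary hp H hH N A B C hS)
  have hlog : 0 < Real.log p := Real.log_pos (by exact_mod_cast hp.one_lt)
  refine sum_rpow_mono Finset.univ (fun i => (A i).card * (B i).card * (C i).card)
    (by have := bccgnsuDelta_pos; positivity) ?_
  linarith [bccgnsuDelta_div_log_le_foxLovaszExponent hp.two_le]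

/-- Closed form `ε_p ≥ 6δ/log p` for `p ≥ 7` (`J(p) ≤ e^{-2δ}`), e.g. `2 + 6δ/log 7 = 2.1746…`.
[cite: BlasiakChurchCohnGrochowNaslundSawinUmans2017, Prop. 4.12 and Thm. B] -/
theorem BCCGNSU2017_thmB_elementary_two_delta {p : ℕ} (hp : p.Prime) (hp7 : 7 ≤ p) (H : Type)
    [AddCommGroup H] [Fintype H] (hH : ∀ x : H, p • x = 0) (N : ℕ) (A B C : Fin N → Finset H)
    (hS : IsSTPP A B C) :
    ∑ i, (((A i).card * (B i).card * (C i).card : ℕ) : ℝ) ^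
        ((2 + 3 * (2 * bccgnsuDelta / Real.log p)) / 3) ≤ (Fintype.card H : ℝ) := by
  refine le_trans ?_ (BCCGNSU2017_thmB_elementary hp H hH N A B C hS)
  have hlog : 0 < Real.log p := Real.log_pos (by exact_mod_cast hp.one_lt)
  refine sum_rpow_mono Finset.univ (fun i => (A i).card * (B i).card * (C i).card)
    (by have := bccgnsuDelta_pos; positivity) ?_
  linarith [two_mul_bccgnsuDelta_div_log_le_foxLovaszExponent hp7]

end Elementary

end Literature.Barriers.MatrixMultiplication

end
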